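import Summits.AtomisticToContinuum.HydrodynamicLimit.Theorems.AntiMazurCoboundariesKineticFluxLdDecayHTheoremReduction
import Summits.AtomisticToContinuum.HydrodynamicLimit.Theorems.AntiMazurCoboundariesKineticFluxLdDecayHTheoremObjectsD
import Summits.AtomisticToContinuum.HydrodynamicLimit.Theorems.AntiMazurCoboundariesKineticFluxLdDecayFirstMomentBudget
import Summits.AtomisticToContinuum.HydrodynamicLimit.Theorems.AntiMazurCoboundariesKineticFluxLdDecayCutProductionLeMoment
import HarnessLib

/-!
# Bounded windows are free, the `A·s` term is idle: `NoPerpetualDissipationTilt ↔ LargeWindowDissipationTilt`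
# (crux `KineticFluxLdDecay`, stmt-AtomisticToContinuum-10967; line `h-theorem-dissipation-budget`, lead c4, reshape 3)

With the wave-1 stubs of the reshaped skeleton LANDED — `stub_firstMomentBudget` (entropy budgets the first velocity moment of
the reduced one-body law, p150392) and `stub_cutProductionLeMoment` (a-priori bound of the cut Hellinger production by the first
velocity moment, p151339) — the bet of the line on the crux's own tilt, `NoPerpetualDissipationTilt` (objects part C), is
EQUIVALENT to its `A`-free large-window core `LargeWindowDissipationTilt` (objects part D):

* `→` of the core: windows `τ ≤ τ₀` cost at most `h · cK(c₀ + s) ≤ (h/τ) · τ₀ cK (c₀ + s)`, of the bet's form with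
  `A = τ₀cK`, `B = τ₀cKc₀` (`noPerpetualDissipationTilt_of`);
* `←` of the bet: `s = KL(G_N^X‖G_N)/(N+1) ≤ 2κ_b` because `|X| ≤ (N+1)κ_b` (`E_G e^X ≥ e^{-(N+1)κ_b}` in the Gibbs variational
  identity, `klDiv_tiltedGibbs_le`), so `(h/τ)(A s + B) ≤ (h/τ)(2Aκ_b + B)` (`largeWindowDissipationTilt_of_bet`).

Hence the registered sub-goal `stub_boundedWindowsReduction : BoundedWindowsReduction`, the corollary
`noPerpetualDissipationTilt_iff_largeWindow`, and — through the landed normal form `stub_hTheoremReduction` (p140516) —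
`kineticFluxLdDecay_of_largeWindowDissipationTilt : LargeWindowDissipationTilt → crux ∧ crux'`: the tree now holds the
kernel-checked normal form CRUX ⟸ `LargeWindowDissipationTilt` (bounded total cut dissipation of the optimal enemy over
arbitrarily long kinetic windows), sorry-free.
-/

noncomputable section

open MeasureTheory ProbabilityTheory Set Filter InformationTheory
open scoped ENNReal

namespace Summit.AtomisticToContinuum.HydrodynamicLimit.Theorems.HTheorem

open Literature.MathematicalPhysics.KineticTheory (T3 V3 hsDiameter localGibbsLaw)
open Literature.Analysis.FluidPDE (HardSphereFlow Config)

/-- Statement of the registered sub-goal `stub_boundedWindowsReduction`: **the bet is equivalent to its large-window core,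
given the two a-priori facts** — `FirstMomentBudget → CutProductionLeMoment → LargeWindowDissipationTilt → NoPerpetualDissipationTilt`
and `NoPerpetualDissipationTilt → LargeWindowDissipationTilt`. -/
def BoundedWindowsReduction : Prop :=
  (FirstMomentBudget → CutProductionLeMoment → LargeWindowDissipationTilt → NoPerpetualDissipationTilt) ∧
    (NoPerpetualDissipationTilt → LargeWindowDissipationTilt)

namespace BoundedWindows


/-- Arithmetic of the bounded windows: `cK(c₀ + s)·h ≤ (h/τ)(T·cK·s + max B (T·cK·c₀))` when `0 < τ ≤ T`. -/
theorem bounded_window_arith {c K c₀ S n h τ T B : ℝ} (hc : 0 ≤ c) (hK : 0 ≤ K) (hc₀ : 0 ≤ c₀) (hS : 0 ≤ S)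
    (hn : 0 < n) (hh : 0 ≤ h) (hτ : 0 < τ) (hτT : τ ≤ T) :
    c * K * (c₀ + S / n) * h ≤ h / τ * (T * (c * K) * S / n + max B (T * (c * K) * c₀)) := by
  have hcK : 0 ≤ c * K := mul_nonneg hc hK
  have hs : 0 ≤ S / n := div_nonneg hS hn.le
  have e : c * K * (c₀ + S / n) * h = h / τ * (τ * (c * K) * (S / n) + τ * (c * K) * c₀) := by
    field_simp
    ring
  have e2 : T * (c * K) * S / n = T * (c * K) * (S / n) := mul_div_assoc _ _ _
  rw [e, e2]
  refine mul_le_mul_of_nonneg_left ?_ (div_nonneg hh hτ.le)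
  have h1 : τ * (c * K) * (S / n) ≤ T * (c * K) * (S / n) :=
    mul_le_mul_of_nonneg_right (mul_le_mul_of_nonneg_right hτT hcK) hs
  have h2 : τ * (c * K) * c₀ ≤ max B (T * (c * K) * c₀) :=
    (mul_le_mul_of_nonneg_right (mul_le_mul_of_nonneg_right hτT hcK) hc₀).trans (le_max_right _ _)
  linarith

/-- **The bet from its core**: bounded windows are free (`CutProductionLeMoment` + `FirstMomentBudget`), large
windows are `LargeWindowDissipationTilt`. -/
theorem noPerpetualDissipationTilt_of (h1 : FirstMomentBudget) (h2 : CutProductionLeMoment)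
    (h3 : LargeWindowDissipationTilt) : NoPerpetualDissipationTilt := by
  obtain ⟨c₀, hc₀, H1⟩ := h1
  obtain ⟨c, hc, H2⟩ := h2
  intro a θ u₀ ha hθ
  obtain ⟨σ₁, hσ₁, H3⟩ := h3 a θ u₀ ha hθ
  refine ⟨min σ₁ (1 / 2), lt_min hσ₁ (by norm_num), fun σ hσ hσlt => ?_⟩
  have hσ1 : σ < σ₁ := hσlt.trans_le (min_le_left _ _)
  have hσ2 : σ ≤ 1 / 2 := (hσlt.trans_le (min_le_right _ _)).le
  obtain ⟨κb, hκb, H3'⟩ := H3 σ hσ hσ1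
  refine ⟨κb, hκb, fun φ g hφ hg hφ1 hgκ horth K hK => ?_⟩
  obtain ⟨τ₀, B, hB, H3''⟩ := H3' φ g hφ hg hφ1 hgκ horth K hK
  have hK0 : 0 ≤ K := zero_le_one.trans hK
  set T : ℝ := max τ₀ 0 with hT
  have hT0 : 0 ≤ T := le_max_right _ _
  refine ⟨T * (c * K), max B (T * (c * K) * c₀), by positivity, hB.trans (le_max_left _ _), fun τ hτ => ?_⟩
  by_cases hlarge : τ₀ < τ
  · -- large windows: the core
    obtain ⟨N₀, hN⟩ := H3'' τ hlarge
    refine ⟨N₀, fun N hNN Φ => (hN N hNN Φ).trans (ENNReal.ofReal_le_ofReal ?_)⟩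
    have hh : 0 ≤ window τ N / τ :=
      div_nonneg (mul_pos hτ (Real.rpow_pos_of_pos (by positivity) _)).le hτ.le
    refine mul_le_mul_of_nonneg_left ?_ hh
    have : 0 ≤ T * (c * K) * (klDiv (tiltedGibbs σ a θ u₀ φ g τ N Φ) (gibbs σ a θ u₀ N Φ)).toReal /
        ((N + 1 : ℕ) : ℝ) := by positivity
    linarith [le_max_left B (T * (c * K) * c₀)]
  · -- bounded windows: free
    have hτT : τ ≤ T := (not_lt.1 hlarge).trans (le_max_left _ _)
    refine ⟨0, fun N _ Φ => ?_⟩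
    haveI hGP : IsProbabilityMeasure (gibbs σ a θ u₀ N Φ) := isProbabilityMeasure_gibbs ha hθ hσ2 u₀ N Φ
    have hgood : gibbs σ a θ u₀ N Φ Φ.goodᶜ = 0 :=
      gibbs_absolutelyContinuous σ a θ u₀ N Φ Φ.measure_compl_good
    have hFm : Measurable (fluxObs θ u₀ φ g N) := measurable_fluxObs θ u₀ hφ.measurable hg.measurable N
    have hFb : ∀ z, |fluxObs θ u₀ φ g N z| ≤ ((N + 1 : ℕ) : ℝ) * κb := abs_fluxObs_le θ u₀ hφ1 hgκ N
    have hh : 0 < window τ N := mul_pos hτ (Real.rpow_pos_of_pos (by positivity) _)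
    obtain ⟨hνP, hνac, hνkl, -, -, -⟩ :=
      stub_windowDuality _ _ Φ (gibbs σ a θ u₀ N Φ) hGP hgood (fluxObs θ u₀ φ g N) hFm ⟨_, hFb⟩
        (window τ N) hh
    haveI : IsProbabilityMeasure (tiltedGibbs σ a θ u₀ φ g τ N Φ) := hνP
    have hS0 : 0 ≤ (klDiv (tiltedGibbs σ a θ u₀ φ g τ N Φ) (gibbs σ a θ u₀ N Φ)).toReal :=
      ENNReal.toReal_nonneg
    have hn : (0 : ℝ) < ((N + 1 : ℕ) : ℝ) := by positivity
    have hcs : 0 ≤ c₀ + (klDiv (tiltedGibbs σ a θ u₀ φ g τ N Φ) (gibbs σ a θ u₀ N Φ)).toReal /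
        ((N + 1 : ℕ) : ℝ) := by positivity
    -- per-time a-priori bound
    have key : ∀ t : ℝ, production (cutDensity K θ u₀ Φ (tiltedGibbs σ a θ u₀ φ g τ N Φ) t) ≤
        ENNReal.ofReal (c * K) * ENNReal.ofReal (c₀ +
          (klDiv (tiltedGibbs σ a θ u₀ φ g τ N Φ) (gibbs σ a θ u₀ N Φ)).toReal / ((N + 1 : ℕ) : ℝ)) := by
      intro t
      obtain ⟨hfP, hfac, -⟩ := stub_oneBodyMarginal σ a θ u₀ N Φ _ hνP hθ hνac t
      haveI : IsProbabilityMeasure (oneBodyLaw θ u₀ Φ (tiltedGibbs σ a θ u₀ φ g τ N Φ) t) := hfP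
      have hprod := H2 (oneBodyLaw θ u₀ Φ (tiltedGibbs σ a θ u₀ φ g τ N Φ) t) inferInstance hfac K hK0
      have hmom := H1 σ a θ u₀ N Φ _ hνP ha hθ hσ2 hνkl t
      exact hprod.trans (mul_le_mul' le_rfl hmom)
    calc ∫⁻ t in Set.Ioo 0 (window τ N), production (cutDensity K θ u₀ Φ (tiltedGibbs σ a θ u₀ φ g τ N Φ) t)
        ≤ ∫⁻ _t in Set.Ioo 0 (window τ N), ENNReal.ofReal (c * K) * ENNReal.ofReal (c₀ +
            (klDiv (tiltedGibbs σ a θ u₀ φ g τ N Φ) (gibbs σ a θ u₀ N Φ)).toReal / ((N + 1 : ℕ) : ℝ)) :=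
          lintegral_mono fun t => key t
      _ = ENNReal.ofReal (c * K) * ENNReal.ofReal (c₀ +
            (klDiv (tiltedGibbs σ a θ u₀ φ g τ N Φ) (gibbs σ a θ u₀ N Φ)).toReal / ((N + 1 : ℕ) : ℝ)) *
            ENNReal.ofReal (window τ N) := by
          rw [lintegral_const, Measure.restrict_apply MeasurableSet.univ, Set.univ_inter, Real.volume_Ioo,
            sub_zero]
      _ = ENNReal.ofReal (c * K * (c₀ +
            (klDiv (tiltedGibbs σ a θ u₀ φ g τ N Φ) (gibbs σ a θ u₀ N Φ)).toReal / ((N + 1 : ℕ) : ℝ)) *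
              window τ N) := by
          rw [← ENNReal.ofReal_mul (by positivity), ← ENNReal.ofReal_mul (by positivity)]
      _ ≤ ENNReal.ofReal (window τ N / τ * (T * (c * K) *
            (klDiv (tiltedGibbs σ a θ u₀ φ g τ N Φ) (gibbs σ a θ u₀ N Φ)).toReal / ((N + 1 : ℕ) : ℝ) +
              max B (T * (c * K) * c₀))) :=
          ENNReal.ofReal_le_ofReal (bounded_window_arith hc hK0 hc₀ hS0 hn hh.le hτ hτT)

/-- `s ≤ 2κ_b`: the relative entropy of the tilted law is at most `2(N+1)κ_b` when `|F| ≤ (N+1)κ_b`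
(`E_G e^X ≥ e^{-(N+1)κ_b}` in the Gibbs variational identity `E_G e^X = exp(E_{G^X}X − KL)`). -/
theorem klDiv_tiltedGibbs_le {σ a θ : ℝ} (ha : 0 < a) (hθ : 0 < θ) (hσ2 : σ ≤ 1 / 2) (u₀ : V3)
    {φ : T3 → ℝ} {g : V3 → ℝ} (hφ : Continuous φ) (hg : Continuous g) (hφ1 : ∀ x, |φ x| ≤ 1) {κb : ℝ}
    (hgκ : ∀ w, |g w| ≤ κb) {τ : ℝ} (hτ : 0 < τ) (N : ℕ) (Φ : Flow σ N) :
    klDiv (tiltedGibbs σ a θ u₀ φ g τ N Φ) (gibbs σ a θ u₀ N Φ) ≠ ⊤ ∧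
      (klDiv (tiltedGibbs σ a θ u₀ φ g τ N Φ) (gibbs σ a θ u₀ N Φ)).toReal ≤
        2 * (((N + 1 : ℕ) : ℝ) * κb) := by
  haveI hGP : IsProbabilityMeasure (gibbs σ a θ u₀ N Φ) := isProbabilityMeasure_gibbs ha hθ hσ2 u₀ N Φ
  have hgood : gibbs σ a θ u₀ N Φ Φ.goodᶜ = 0 :=
    gibbs_absolutelyContinuous σ a θ u₀ N Φ Φ.measure_compl_good
  have hFm : Measurable (fluxObs θ u₀ φ g N) := measurable_fluxObs θ u₀ hφ.measurable hg.measurable N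
  have hFb : ∀ z, |fluxObs θ u₀ φ g N z| ≤ ((N + 1 : ℕ) : ℝ) * κb := abs_fluxObs_le θ u₀ hφ1 hgκ N
  have hh : 0 < window τ N := mul_pos hτ (Real.rpow_pos_of_pos (by positivity) _)
  obtain ⟨hνP, hνac, hνkl, hdual, -, -⟩ :=
    stub_windowDuality _ _ Φ (gibbs σ a θ u₀ N Φ) hGP hgood (fluxObs θ u₀ φ g N) hFm ⟨_, hFb⟩
      (window τ N) hh
  refine ⟨hνkl, ?_⟩
  haveI : IsProbabilityMeasure (tiltedGibbs σ a θ u₀ φ g τ N Φ) := hνP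
  have hXb : ∀ z, |windowAvg Φ (fluxObs θ u₀ φ g N) (window τ N) z| ≤ ((N + 1 : ℕ) : ℝ) * κb :=
    fun z => abs_windowAvg_le Φ hFb hh z
  -- `e^{-(N+1)κ_b} ≤ E_G e^X = exp(E_{G^X} X − KL)`
  have hlow : ENNReal.ofReal (Real.exp (-(((N + 1 : ℕ) : ℝ) * κb))) ≤
      ∫⁻ z, ENNReal.ofReal (Real.exp (windowAvg Φ (fluxObs θ u₀ φ g N) (window τ N) z))
        ∂(gibbs σ a θ u₀ N Φ) := by
    calc ENNReal.ofReal (Real.exp (-(((N + 1 : ℕ) : ℝ) * κb)))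
        = ∫⁻ _z, ENNReal.ofReal (Real.exp (-(((N + 1 : ℕ) : ℝ) * κb))) ∂(gibbs σ a θ u₀ N Φ) := by
          rw [lintegral_const, measure_univ, mul_one]
      _ ≤ _ := lintegral_mono fun z =>
          ENNReal.ofReal_le_ofReal (Real.exp_le_exp.2 (neg_le_of_abs_le (hXb z)))
  rw [hdual, ENNReal.ofReal_le_ofReal_iff (Real.exp_pos _).le, Real.exp_le_exp] at hlow
  -- `E_{G^X} X ≤ (N+1)κ_b`
  have hXm : AEMeasurable (windowAvg Φ (fluxObs θ u₀ φ g N) (window τ N)) (tiltedGibbs σ a θ u₀ φ g τ N Φ) :=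
    aemeasurable_windowAvg Φ (hνac hgood) hFm _
  have hXi : Integrable (windowAvg Φ (fluxObs θ u₀ φ g N) (window τ N)) (tiltedGibbs σ a θ u₀ φ g τ N Φ) :=
    integrable_of_aemeasurable_of_abs_le hXm hXb
  have hEX : ∫ z, windowAvg Φ (fluxObs θ u₀ φ g N) (window τ N) z ∂(tiltedGibbs σ a θ u₀ φ g τ N Φ) ≤
      ((N + 1 : ℕ) : ℝ) * κb := by
    have h1 := integral_mono hXi (integrable_const (((N + 1 : ℕ) : ℝ) * κb))
      fun z => (le_abs_self _).trans (hXb z)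
    rwa [integral_const, probReal_univ, one_smul] at h1
  change -(((N + 1 : ℕ) : ℝ) * κb) ≤
    (∫ z, windowAvg Φ (fluxObs θ u₀ φ g N) (window τ N) z ∂(tiltedGibbs σ a θ u₀ φ g τ N Φ)) -
      (klDiv (tiltedGibbs σ a θ u₀ φ g τ N Φ) (gibbs σ a θ u₀ N Φ)).toReal at hlow
  linarith

/-- **The core from the bet** (converse; the reshape loses nothing): with `s ≤ 2κ_b` the bet's budget
`(h/τ)(A s + B)` is at most `(h/τ)(2Aκ_b + B)` at every window `τ > 0`. -/
theorem largeWindowDissipationTilt_of_bet (hE : NoPerpetualDissipationTilt) : LargeWindowDissipationTilt := by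
  intro a θ u₀ ha hθ
  obtain ⟨σ₁, hσ₁, H⟩ := hE a θ u₀ ha hθ
  refine ⟨min σ₁ (1 / 2), lt_min hσ₁ (by norm_num), fun σ hσ hσlt => ?_⟩
  have hσ1 : σ < σ₁ := hσlt.trans_le (min_le_left _ _)
  have hσ2 : σ ≤ 1 / 2 := (hσlt.trans_le (min_le_right _ _)).le
  obtain ⟨κb, hκb, H'⟩ := H σ hσ hσ1
  refine ⟨κb, hκb, fun φ g hφ hg hφ1 hgκ horth K hK => ?_⟩
  obtain ⟨A, B, hA, hB, H''⟩ := H' φ g hφ hg hφ1 hgκ horth K hK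
  refine ⟨0, 2 * A * κb + B, by positivity, fun τ hτ => ?_⟩
  obtain ⟨N₀, hN⟩ := H'' τ hτ
  refine ⟨N₀, fun N hNN Φ => (hN N hNN Φ).trans (ENNReal.ofReal_le_ofReal ?_)⟩
  obtain ⟨-, hs⟩ := klDiv_tiltedGibbs_le ha hθ hσ2 u₀ hφ hg hφ1 hgκ hτ N Φ
  have hh : 0 ≤ window τ N / τ :=
    div_nonneg (mul_pos hτ (Real.rpow_pos_of_pos (by positivity) _)).le hτ.le
  refine mul_le_mul_of_nonneg_left ?_ hh
  have hn : (0 : ℝ) < ((N + 1 : ℕ) : ℝ) := by positivity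
  have hs' : (klDiv (tiltedGibbs σ a θ u₀ φ g τ N Φ) (gibbs σ a θ u₀ N Φ)).toReal / ((N + 1 : ℕ) : ℝ) ≤
      2 * κb := by
    rw [div_le_iff₀ hn]
    linarith
  rw [mul_div_assoc]
  nlinarith [mul_le_mul_of_nonneg_left hs' hA]


end BoundedWindows

/-- **Registered sub-goal `stub_boundedWindowsReduction`**: the bet ⟺ its large-window core given the a-priori facts. -/
theorem stub_boundedWindowsReduction : BoundedWindowsReduction :=
  ⟨BoundedWindows.noPerpetualDissipationTilt_of, BoundedWindows.largeWindowDissipationTilt_of_bet⟩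

/-- **The bet is equivalent to its `A`-free large-window core** (with the landed `stub_firstMomentBudget`,
`stub_cutProductionLeMoment`). -/
theorem noPerpetualDissipationTilt_iff_largeWindow : NoPerpetualDissipationTilt ↔ LargeWindowDissipationTilt :=
  ⟨BoundedWindows.largeWindowDissipationTilt_of_bet,
    BoundedWindows.noPerpetualDissipationTilt_of stub_firstMomentBudget stub_cutProductionLeMoment⟩

/-- **Normal form of the line after reshape 3**: the large-window core alone implies the crux (both route copies), through
the landed `stub_hTheoremReduction`. -/
theorem kineticFluxLdDecay_of_largeWindowDissipationTilt (h : LargeWindowDissipationTilt) :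
    Summit.AtomisticToContinuum.HydrodynamicLimit.Theses.AntiMazurCoboundaries.KineticFluxLdDecay ∧
      Summit.AtomisticToContinuum.HydrodynamicLimit.Theses.FluxGibbsianityLdDrude.KineticFluxLdDecay :=
  stub_hTheoremReduction (noPerpetualDissipationTilt_iff_largeWindow.2 h)

end Summit.AtomisticToContinuum.HydrodynamicLimit.Theorems.HTheorem

end
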